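import Summits.CriticalPhenomena.PercolationContinuityZ3.Theorems.Transplant.SkelPhiNegReachHabResG
import Summits.CriticalPhenomena.PercolationContinuityZ3.Theorems.Transplant.KNParaChainLocDN
import Summits.CriticalPhenomena.PercolationContinuityZ3.Theorems.Transplant.KNParaChainCorridorSN
import Summits.CriticalPhenomena.PercolationContinuityZ3.Theorems.Transplant.SkelPhiParaFrameChangeFine
import HarnessLib

/-!
# N1 (the `{±1}` node), (C) column under RULING B.15 (S1, small arrival box): THE ONE-FRAME CORRIDOR RESIDUE — `Skel.ReachOblAtHN` at one probe for
# ANY scheme `S` carrying the geometry records, from the scheme-generic two-window assembly `reachOblAtHN_of_chain₂` (C-A1, p279103) with BOTH windows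
# over the SAME run frame `R = runX φ c₀ n h 1` (base vertex `c₀` with `F c₀ = cen y`): segment 1 := the signed v-rounds `(P_A.scheduleN 1 0 …)` (`LocPrmD`,
# C-S1), segment 2 := the run-frame segment `corrRunSchedS P_B … B aB σB …` (u-rounds ⧺ signed band, C-N5b); the cross link is the containment join
# `P_A.core (N_A+1) ⊆ P_B.core 0` in the same frame (no frame change); `hM0` is DISCHARGED from the arrival box's fine footprint `|F v − F c₀| ≤ (K₀, K₁)`
# by the pointwise frame change `runX_mem_Icc_of_fine` (p278446); the rooms enter in VERTEX form (discharged at the scheme of record by the (C-R)/(C-A4)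
# readings and `SkelPhiNegReachRoomsB`); chain data, true targets, counts, kits, rim excess verbatim as in C-A3.

builds on p205010 (kernel theorem, internal audit signed; external expert review pending) — nothing in this file uses p205010; nothing here is a
claim about the open node `SamePDropOfSkeletonNeg`.
Lane `prim-bschramm`, seat `prim-bschramm-p5` (gen 9; (C) lineage; C-STEP0.md §4–§5); helper file (`--supports stmt-CriticalPhenomena-4575`).

* **`Skelφ.reachOblAtHN_negCorridor1`**.
[cite: KozmaNitzan2024, §4 Lemma 12 (pp. 23–25), p. 26 (M_x, H_{v,x}), p. 30 (Step IV), p. 31] [cite: MartineauTassion2017, §4.3 Lemma 4.2]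
-/

noncomputable section

open MeasureTheory ProbabilityTheory
open scoped ENNReal Classical

namespace Summit.CriticalPhenomena.PercolationContinuityZ3.Theorems

namespace Transplant

namespace Skelφ

open Literature.Probability.Percolation Literature.Probability.LatticeModels SimpleGraph GadgetSystem ProbeHistory HSiteScheme Contour KNCells
open KNCells.KSchA KNLevels ChainPlanar ChainPara
open Literature.Probability.Percolation.KozmaNitzan.Cells (oth)
open BoxProdZ2 (ConcRadiiG)
open TwoAxis.Para (modulus)
open Skel (ReachOblAtHN)

variable {V : Type} [DecidableEq V] {G : SimpleGraph V} [G.LocallyFinite] {φ : V → Site 2}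

/-- `oth 0 = 1` on `Fin 2`. [folklore] -/
private theorem oth_zero₁' : oth (0 : Fin 2) = 1 := by decide

/-- `oth 1 = 0` on `Fin 2`. [folklore] -/
private theorem oth_one₁' : oth (1 : Fin 2) = 0 := by decide

/-- **THE ONE-FRAME CORRIDOR RESIDUE** (signed v-rounds ⟶ u-rounds ⟶ signed band, all in `runX φ c₀ n h 1`), for any scheme `S` with the geometry
records.  Discharged here: `hM0` (from the arrival box's fine footprint `(K₀, K₁)` about `F c₀` and the frame-change inequalities `ha hBx hb` into the
v-rounds' start box `{|⌊β′/U⌋| ≤ L0_A, |α| ≤ W_A}`), the cross link (`join_AB`-type containment in the same frame, as hypotheses `hjoinA/hregA`); kept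
as hypotheses: the vertex-level rooms of the three segments and of the last core, chain data / true targets / counts / kits / rim excess.
[cite: KozmaNitzan2024, §4 Lemma 12 (pp. 23–25), p. 30 (Step IV), p. 31] [cite: MartineauTassion2017, §4.3 Lemma 4.2] -/
theorem reachOblAtHN_negCorridor1 {t₀ : V} {A : ℤ} (hA : 0 < A) {n : ℕ} (hn : 1 ≤ n) {h vα vβ : ℤ} (hm : 0 < modulus n h vα vβ)
    {c₀' c₁' s₀ s₁ D : ℤ} (hc₀' : 0 < c₀') (hc₁' : 0 < c₁') (hD : 0 < D)
    (F : V → Site 2) (hFdef : F = fineSkel φ t₀ A n h vα vβ c₀' c₁' s₀ s₁ D)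
    (c₀ : V) (R : V → Site 2) (hRdef : R = runX φ c₀ n h 1) (hlipR : Lip G R)
    {S : KSchA V ℕ} {FD : FaceData V ℕ} {LD : LevelData V ℕ}
    (hL : LevelGeom G S.Γ FD LD) (hQ : QSepGeom G S.Γ) (hSt : StepsGeom S.Γ FD) (hEx : ExitGeom G S.Γ)
    {hist : ProbeHistory V} {e : Site 2 × MDir} (hV : S.Valid₂ G hist e) {a' : ℕ} (ha' : a' ∈ S.Γ.anchSet (S.aOf₁ G hist e) (tgt e))
    {du : MDir} (hdu : du ∈ S.onward G hist (tgt e)) {nmax : ℕ}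
    (Ω : Finset V) (hΩ : Ω = S.Γ.Ewv (S.aOf₁ G hist e) e.1 e.2 ∪ FD.Hfull a' (tgt e) du)
    -- the arrival box's fine footprint about `F c₀` and its frame change into the v-rounds' start box
    {K₀ K₁ : ℕ} (hM0f : ∀ v ∈ S.Γ.M (S.aOf₁ G hist e) (tgt e), |F v 0 - F c₀ 0| ≤ K₀ ∧ |F v 1 - F c₀ 1| ≤ K₁)
    {aW Bx bL : ℤ} (ha : D * (c₁' * (n : ℤ) * (K₀ + 1) + c₀' * |vα| * (K₁ + 1)) ≤ c₀' * c₁' * A * modulus n h vα vβ * aW)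
    (hBx : D * ((K₁ : ℤ) + 1) ≤ c₁' * A * Bx) (hb : Bx / (shearUnit n h : ℤ) + 1 ≤ bL)
    -- segment 1: signed v-rounds (axis `1`, centre `0`)
    (PA : LocPrmD) (hPA : LocOKD PA) (hdL : |PA.d| ≤ PA.Lb) (haW : aW ≤ PA.W) (hbL : bL ≤ PA.L0)
    -- segment 2: the run-frame segment (u-rounds `P_B`, signed band `B` along `aB`), joined to segment 1 by containment
    (PB : LocPrm) (hPB : LocOK PB) (B : RunPrm) (aB : Fin 2) {σB : ℤ} (hσB : σB = 1 ∨ σB = -1) (hB : RunOK B) (heb : B.eb = B.ea)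
    (hR' : B.ea = PB.e) (hjoin : (PB.scheduleN 0 0 hPB).core (PB.N + 1) ⊆ (B.scheduleN aB hσB 0 hB heb).core 0)
    (hreg : (B.scheduleN aB hσB 0 hB heb).core 0 ⊆ (PB.scheduleN 0 0 hPB).region PB.N)
    (hjoinA : (PA.scheduleN 1 0 hPA hdL).core (PA.N + 1) ⊆ (PB.scheduleN 0 0 hPB).core 0)
    -- the vertex-level rooms
    (hroomA : ∀ k ≤ PA.N, ∀ v ∈ Ω, R v ∈ PA.pregion 1 0 k → v ∈ S.Γ.Q (S.aOf₁ G hist e) (tgt e) ∪ S.Γ.Efar a' (tgt e) du)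
    (hroom₂ : ∀ k ≤ PB.N, ∀ v ∈ Ω, R v ∈ PB.pregion 0 0 k → v ∈ S.Γ.Q (S.aOf₁ G hist e) (tgt e) ∪ S.Γ.Efar a' (tgt e) du)
    (hroomB : ∀ j ≤ B.N, ∀ v ∈ Ω, R v ∈ B.pregion aB σB 0 j → v ∈ S.Γ.Q (S.aOf₁ G hist e) (tgt e) ∪ S.Γ.Efar a' (tgt e) du)
    (hroomL : ∀ v ∈ Ω, R v ∈ B.pcore aB σB 0 (B.N + 1) → v ∈ S.Γ.M a' (tgt e + stepVec du))
    (hlen : PA.N + 1 + (PB.N + 1 + B.N) ≤ nmax)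
    -- chain data over the ONE frame
    (S₁f S₂f : SchedFrame) (hS₁f : S₁f = (PA.scheduleN 1 0 hPA hdL).toFrame)
    (hS₂f : S₂f = (corrRunSchedS PB hPB B aB hσB hB heb hR' hjoin hreg).toFrame)
    (C₁ C₂ : WinChainData V) (hPo₁ : C₁.o = S.Γ.root) (hPo₂ : C₂.o = S.Γ.root)
    (hPS₁ : C₁.Sfin = S.Sx G hist e (S.aOf₁ G hist e) a' du) (hPS₂ : C₂.Sfin = S.Sx G hist e (S.aOf₁ G hist e) a' du)
    (hRim₁ : ∀ k, C₁.Rim k ⊆ (planarWindowIn hlipR Ω).stepDF S₁f k) (hRim₂ : ∀ k, C₂.Rim k ⊆ (planarWindowIn hlipR Ω).stepDF S₂f k)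
    (hRl₁ : C₁.Rlev + 1 ≤ S₁f.R') (hRl₂ : C₂.Rlev + 1 ≤ S₂f.R') (hj₁ : C₁.j₁ ≤ C₁.Rlev) (hj₂ : C₂.j₁ ≤ C₂.Rlev)
    (hTne₁ : ∀ k ≤ S₁f.N, ((planarWindowIn hlipR Ω).coreTF S₁f k).Nonempty) (hTne₂ : ∀ k ≤ S₂f.N, ((planarWindowIn hlipR Ω).coreTF S₂f k).Nonempty)
    -- analytic inputs
    {Δ' : ℕ} {δ η : ℝ}
    (hcount₁ : 1 / (1 - (S.p : ℝ)) ^ (Δ' * C₁.N) ≤ δ * ((Finset.Icc C₁.j₀ C₁.j₁).card : ℝ))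
    (hcount₂ : 1 / (1 - (S.p : ℝ)) ^ (Δ' * C₂.N) ≤ δ * ((Finset.Icc C₂.j₀ C₂.j₁).card : ℝ))
    (hkits₁ : ∀ k ≤ S₁f.N, ∀ j ∈ Finset.Icc C₁.j₀ C₁.j₁, ∃ (σ : SData V) (Sz : Finset V),
      SHyp (C₁.stepLF (planarWindowIn hlipR Ω) S₁f k) j σ ∧ σ.N ≤ C₁.N ∧
      (1 - (S.p : ℝ) ^ σ.sB) ^ σ.k ≤ δ ∧ Sz ⊆ (C₁.stepLF (planarWindowIn hlipR Ω) S₁f k).X j ∧ Sz ⊆ (planarWindowIn hlipR Ω).stepDF S₁f k ∧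
      (∀ x ∈ σ.K, ∀ e' ∈ σ.seed x, e' ∉ wireSet (↑Sz : Set V)) ∧ (∀ x ∈ σ.K, σ.face x ⊆ Sz) ∧
      (∀ x ∈ σ.K, 1 - 3 * δ ≤ (prodBernoulli (S.Wcor G FD hist e (S.aOf₁ G hist e) a' du)).real {ω | ∃ u ∈ σ.face x,
        1 - δ < (prodBernoulli (pinW (S.Wcor G FD hist e (S.aOf₁ G hist e) a' du) (wireSet (↑Sz : Set V)) ω)).real
          (⋃ t' ∈ C₁.coreEF (planarWindowIn hlipR Ω) S₁f k, openConnIn (↑((planarWindowIn hlipR Ω).stepDF S₁f k) : Set V) u t')}))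
    (hkits₂ : ∀ k ≤ S₂f.N, ∀ j ∈ Finset.Icc C₂.j₀ C₂.j₁, ∃ (σ : SData V) (Sz : Finset V),
      SHyp (C₂.stepLF (planarWindowIn hlipR Ω) S₂f k) j σ ∧ σ.N ≤ C₂.N ∧
      (1 - (S.p : ℝ) ^ σ.sB) ^ σ.k ≤ δ ∧ Sz ⊆ (C₂.stepLF (planarWindowIn hlipR Ω) S₂f k).X j ∧ Sz ⊆ (planarWindowIn hlipR Ω).stepDF S₂f k ∧
      (∀ x ∈ σ.K, ∀ e' ∈ σ.seed x, e' ∉ wireSet (↑Sz : Set V)) ∧ (∀ x ∈ σ.K, σ.face x ⊆ Sz) ∧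
      (∀ x ∈ σ.K, 1 - 3 * δ ≤ (prodBernoulli (S.Wcor G FD hist e (S.aOf₁ G hist e) a' du)).real {ω | ∃ u ∈ σ.face x,
        1 - δ < (prodBernoulli (pinW (S.Wcor G FD hist e (S.aOf₁ G hist e) a' du) (wireSet (↑Sz : Set V)) ω)).real
          (⋃ t' ∈ C₂.coreEF (planarWindowIn hlipR Ω) S₂f k, openConnIn (↑((planarWindowIn hlipR Ω).stepDF S₂f k) : Set V) u t')}))
    (hη : η ≤ δ / 2)
    (hexc₁ : ∀ k ≤ S₁f.N, (prodBernoulli (S.Wcor G FD hist e (S.aOf₁ G hist e) a' du)).real (⋃ t' ∈ C₁.Rim k, openConn S.Γ.root t') ≤ η)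
    (hexc₂ : ∀ k ≤ S₂f.N, (prodBernoulli (S.Wcor G FD hist e (S.aOf₁ G hist e) a' du)).real (⋃ t' ∈ C₂.Rim k, openConn S.Γ.root t') ≤ η) :
    ReachOblAtHN G nmax S FD Δ' δ hist e a' du := by
  set y := tgt e with hydef
  -- frame identities
  have hN₁ : S₁f.N = PA.N := by rw [hS₁f]; rfl
  have hN₂ : S₂f.N = PB.N + 1 + B.N := by rw [hS₂f]; rfl
  have hcore₁ : ∀ k, S₁f.core k = (PA.scheduleN 1 0 hPA hdL).core k := fun k => by rw [hS₁f]; rfl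
  have hregion₁ : ∀ k, S₁f.region k = (PA.scheduleN 1 0 hPA hdL).region k := fun k => by rw [hS₁f]; rfl
  have hcore₂ : ∀ k, S₂f.core k = (corrRunSchedS PB hPB B aB hσB hB heb hR' hjoin hreg).core k := fun k => by rw [hS₂f]; rfl
  have hregion₂ : ∀ k, S₂f.region k = (corrRunSchedS PB hPB B aB hσB hB heb hR' hjoin hreg).region k := fun k => by rw [hS₂f]; rfl
  refine reachOblAtHN_of_chain₂ hlipR hlipR hL hQ hSt hEx hV ha' hdu Ω hΩ S₁f S₂f ?_ ?_ ?_ ?_ ?_ (by rw [hN₁, hN₂]; exact hlen) C₁ C₂ hPo₁ hPo₂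
    hPS₁ hPS₂ hRim₁ hRim₂ hRl₁ hRl₂ hj₁ hj₂ hTne₁ hTne₂ hcount₁ hcount₂ hkits₁ hkits₂ hη hexc₁ hexc₂
  · -- `M_α(y) ⊆ core 0` through the frame change at `c₀`
    intro v hv
    obtain ⟨h0, h1⟩ := hM0f v hv
    have hbox := runX_mem_Icc_of_fine (s₀ := s₀) (s₁ := s₁) hA hn hm hc₀' hc₁' hD t₀ c₀ v (Or.inl rfl) (by rw [hFdef] at h0; exact h0)
      (by rw [hFdef] at h1; exact h1) ha hBx hb
    rw [hcore₁, LocPrmD.scheduleN_core, LocPrmD.mem_pcore_iff, hRdef]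
    rw [Finset.mem_Icc, Pi.le_def, Pi.le_def, Fin.forall_fin_two, Fin.forall_fin_two] at hbox
    simp only [Pi.neg_apply, Matrix.cons_val_zero, Matrix.cons_val_one] at hbox
    simp only [Pi.zero_apply, sub_zero, oth_one₁', Nat.cast_zero, zero_mul, add_zero, LocPrmD.toLoc, LocPrm.L_zero]
    exact ⟨abs_le.2 ⟨by linarith [hbox.1.2], by linarith [hbox.2.2]⟩, abs_le.2 ⟨by linarith [hbox.1.1], by linarith [hbox.2.1]⟩⟩
  · -- v-round regions
    intro k hk v hvΩ hvR
    rw [hregion₁, LocPrmD.scheduleN_region] at hvR; rw [hN₁] at hk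
    exact hroomA k hk v hvΩ hvR
  · -- the cross link: containment join in the same frame
    rw [hcore₁, hN₁, hcore₂, corrRunSchedS_core_zero, ← LocPrm.scheduleN_core PB 0 0 hPB]
    exact WinIn_mono _ subset_rfl hjoinA
  · -- run-frame segment regions: rounds' or band's
    intro k hk v hvΩ hvR
    rw [hN₂] at hk; rw [hregion₂] at hvR
    rcases corrRunSchedS_region_cases PB hPB B aB hσB hB heb hR' hjoin hreg hk with ⟨hk', hrg⟩ | ⟨j, hj, -, hrg⟩
    · rw [hrg] at hvR; exact hroom₂ k hk' v hvΩ hvR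
    · rw [hrg] at hvR; exact hroomB j hj v hvΩ hvR
  · -- the last core
    intro v hvΩ hvR
    have hN₂' : S₂f.N = (corrRunSchedS PB hPB B aB hσB hB heb hR' hjoin hreg).N := by rw [hS₂f]; rfl
    rw [hcore₂, hN₂', corrRunSchedS_core_last] at hvR
    exact hroomL v hvΩ hvR

end Skelφ

end Transplant

end Summit.CriticalPhenomena.PercolationContinuityZ3.Theorems

end
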